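import Summits.QuantumFields.YangMills.Theorems.BalabanStepParabolic.Negative.NoContinuityJunk
import Summits.QuantumFields.YangMills.Theorems.BalabanStepParabolic.Negative.CurvatureOnly
import Summits.QuantumFields.YangMills.Theorems.BalabanStepParabolic.Negative.TorusRegularity
import Summits.QuantumFields.YangMills.Theorems.BalabanStepParabolic.Negative.ThinChartReduction
import Literature.MathematicalPhysics.QuantumFieldTheory.BalabanRegulatorChart
import Summits.QuantumFields.YangMills.Theorems.BalabanStepParabolic.Negative.OverTunedLimit
import Summits.QuantumFields.YangMills.Theorems.ParabolicTrajectoryBalabanStepParabolicStubParabolicBlock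
import Summits.QuantumFields.YangMills.Theorems.ParabolicTrajectoryBalabanStepParabolicStubRealisation
import HarnessLib

namespace Summit.QuantumFields.YangMills.Theorems.BalabanStepParabolic.Negative

open scoped SchwartzMap
open MeasureTheory Filter Topology
open Literature.MathematicalPhysics.QuantumFieldTheory Literature.MathematicalPhysics.AQFT
open Literature.MathematicalPhysics.QuantumLattice

noncomputable section

/-!
# `BalabanStepParabolic` — the over-tuned thin inhabitant and the EQUIVALENCE (evidence copy v3, single file;
# tree version: `Negative/OverTunedLimit.lean` (p73944) + `Negative/OverTuned{Shells (p74721), Germ, Continuity,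
# Inhabitant, Equivalence}.lean`)

Kernel-checked content of the drefute gen-2 finding `stub-misstated: stub_regulatorChartOdd`
(`Cruxes/BalabanStepParabolic/DREFUTE2-stub_regulatorChartOdd.md`). For odd `M ≥ 2`, every compact `G`, every `r`:
* `nonempty_iff_uniformOverTuned : Nonempty (BalabanBanachStep G r M) ↔ ∃ B > 0, UOT(r, M, B)`
* `nonempty_regulatorChart_iff_uniformOverTuned : Nonempty (RegulatorChart G r M) ↔ ∃ B > 0, UOT(r, M, B)`
where `UOT(r, M, B) := ∀ B' L m h, IsOffDiagonal … → ∀ ε > 0, ∃ k₀, ∀ k ≥ k₀, ∀ β ≥ B k − B',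
|wilsonCentredSchwinger r.ρ β ((M^k(2L+1)−1)/2) 1 curvatureᵐ⁺¹ ((blockDilate M)^[k] ∘ h)| ≤ ε` — Wilson's lattice
gauge theory alone: no chart, no step, no `b₀`, no regulator. lean check rc 0, 0 sorry, 0 warnings, std axioms.
-/

section Counting

variable (M : ℕ)

/-- One junk step in inverse-square coordinates: `1/φ(g)² ≤ 1/g² − 2b + 3b²g²` (`b = log M ≥ 0`, `g > 0`). [folklore] -/
theorem inv_sq_φJ_le {g : ℝ} (hg : 0 < g) (hb : 0 ≤ Real.log M) :
    1 / (φJ M g) ^ 2 ≤ 1 / g ^ 2 - 2 * Real.log M + 3 * (Real.log M) ^ 2 * g ^ 2 := by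
  set b := Real.log M with hbdef
  have hu : 0 ≤ b * g ^ 2 := by positivity
  have hφ : φJ M g = g * (1 + b * g ^ 2) := by simp only [φJ, ← hbdef]; ring
  have hpos : 0 < 1 + b * g ^ 2 := by positivity
  rw [hφ, mul_pow]
  have hg2 : 0 < g ^ 2 := by positivity
  have hq : 0 < (1 + b * g ^ 2) ^ 2 := by positivity
  rw [div_le_iff₀ (by positivity)]
  -- (1/g² − 2b + 3b²g²)·g²(1+bg²)² ≥ 1  ⟸  (1 − 2u + 3u²)(1+u)² ≥ 1 with u = b g²
  have key : 1 ≤ (1 - 2 * (b * g ^ 2) + 3 * (b * g ^ 2) ^ 2) * (1 + b * g ^ 2) ^ 2 := by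
    nlinarith [pow_nonneg hu 3, pow_nonneg hu 4, sq_nonneg (b * g ^ 2)]
  have e : (1 / g ^ 2 - 2 * b + 3 * b ^ 2 * g ^ 2) * (g ^ 2 * (1 + b * g ^ 2) ^ 2) =
      (1 - 2 * (b * g ^ 2) + 3 * (b * g ^ 2) ^ 2) * (1 + b * g ^ 2) ^ 2 := by
    field_simp
  rw [e]
  exact key

/-- The junk flow is positive on positive couplings (`log M ≥ 0`). [folklore] -/
theorem φJ_pos {g : ℝ} (hg : 0 < g) (hb : 0 ≤ Real.log M) : 0 < φJ M g := by
  unfold φJ; nlinarith [pow_pos hg 3, mul_nonneg hb (pow_pos hg 3).le]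

/-- The junk flow does not decrease non-negative couplings. [folklore] -/
theorem le_φJ {g : ℝ} (hg : 0 ≤ g) (hb : 0 ≤ Real.log M) : g ≤ φJ M g := by
  unfold φJ; nlinarith [pow_nonneg hg 3]

/-- Iterates of the junk flow stay above the starting coupling and non-negative. [folklore] -/
theorem le_iterate_φJ (hb : 0 ≤ Real.log M) {γ : ℝ} (hγ : 0 ≤ γ) (j : ℕ) :
    γ ≤ (φJ M)^[j] γ := by
  induction j with
  | zero => simp
  | succ j ih =>
    rw [Function.iterate_succ_apply']
    exact ih.trans (le_φJ M (hγ.trans ih) hb)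

/-- Iterates of the junk flow are monotone in the number of steps. [folklore] -/
theorem iterate_φJ_mono (hb : 0 ≤ Real.log M) {γ : ℝ} (hγ : 0 ≤ γ) {j j' : ℕ} (hjj : j ≤ j') :
    (φJ M)^[j] γ ≤ (φJ M)^[j'] γ := by
  obtain ⟨d, rfl⟩ := Nat.exists_eq_add_of_le hjj
  rw [add_comm, Function.iterate_add_apply]
  exact le_iterate_φJ M hb ((hγ.trans (le_iterate_φJ M hb hγ j))) d

/-- The junk flow is continuous. [folklore] -/
theorem continuous_φJ : Continuous (φJ M) := by unfold φJ; fun_prop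

/-- **Fast phase**: above the threshold `γ² ≥ 1/(3b)` every junk step multiplies the coupling by at
least `4/3`, so `(4/3)^j γ ≤ φ^j(γ)`. [folklore] -/
theorem growth_iterate_φJ (hb : 0 < Real.log M) {γ : ℝ} (hγ0 : 0 < γ) (hγ : 1 / (3 * Real.log M) ≤ γ ^ 2)
    (j : ℕ) : (4 / 3 : ℝ) ^ j * γ ≤ (φJ M)^[j] γ := by
  induction j with
  | zero => simp
  | succ j ih =>
    rw [Function.iterate_succ_apply', pow_succ]
    set y := (φJ M)^[j] γ with hy
    have hyγ : γ ≤ y := le_iterate_φJ M hb.le hγ0.le j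
    have hy0 : 0 < y := hγ0.trans_le hyγ
    have hy2 : 1 / (3 * Real.log M) ≤ y ^ 2 := hγ.trans (pow_le_pow_left₀ hγ0.le hyγ 2)
    have hby : 1 / 3 ≤ Real.log M * y ^ 2 := by
      rw [div_le_iff₀ (by positivity)] at hy2
      linarith
    have hstep : 4 / 3 * y ≤ φJ M y := by
      unfold φJ
      nlinarith
    calc (4 / 3 : ℝ) ^ j * (4 / 3) * γ = 4 / 3 * ((4 / 3 : ℝ) ^ j * γ) := by ring
      _ ≤ 4 / 3 * y := by gcongr
      _ ≤ φJ M y := hstep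

/-- **Slow phase**: below the threshold one junk step lowers `1/g²` by at least `b`. [folklore] -/
theorem inv_sq_φJ_le_sub (hb : 0 < Real.log M) {g : ℝ} (hg : 0 < g) (hsmall : g ^ 2 ≤ 1 / (3 * Real.log M)) :
    1 / (φJ M g) ^ 2 ≤ 1 / g ^ 2 - Real.log M := by
  have h := inv_sq_φJ_le M hg hb.le
  have h3 : 3 * (Real.log M) ^ 2 * g ^ 2 ≤ Real.log M := by
    rw [le_div_iff₀ (by positivity)] at hsmall
    nlinarith
  linarith

/-- **Parabolic counting.** If the depth-`k` junk orbit of a positive coupling `γ` has not passed `T`,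
then `b k ≤ 1/γ² + b N` for any `N` with `3 b T² < (16/9)^N` (`b = log M > 0`): at most `N` steps are fast,
and every slow step costs `b` in `1/g²`. [folklore] -/
theorem counting_φJ (hb : 0 < Real.log M) {T : ℝ} {N : ℕ} (hN : 3 * Real.log M * T ^ 2 < (16 / 9 : ℝ) ^ N) :
    ∀ (k : ℕ) (γ : ℝ), 0 < γ → (φJ M)^[k] γ ≤ T → Real.log M * k ≤ 1 / γ ^ 2 + Real.log M * N := by
  intro k
  induction k with
  | zero => intro γ hγ _; simp only [CharP.cast_eq_zero, mul_zero]; positivity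
  | succ k ih =>
    intro γ hγ hT
    by_cases hsmall : γ ^ 2 ≤ 1 / (3 * Real.log M)
    · -- slow step first, then induction
      have hγ' : 0 < φJ M γ := φJ_pos M hγ hb.le
      rw [Function.iterate_succ_apply] at hT
      have h1 := ih (φJ M γ) hγ' hT
      have h2 := inv_sq_φJ_le_sub M hb hγ hsmall
      push_cast
      nlinarith
    · -- fast phase: all k+1 steps multiply by ≥ 4/3, so k+1 < N
      rw [not_le] at hsmall
      have hgrow := growth_iterate_φJ M hb hγ hsmall.le (k + 1)
      have hle : (4 / 3 : ℝ) ^ (k + 1) * γ ≤ T := hgrow.trans hT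
      have hT0 : 0 ≤ T := le_trans (by positivity) hle
      have hsq : ((4 / 3 : ℝ) ^ (k + 1) * γ) ^ 2 ≤ T ^ 2 := pow_le_pow_left₀ (by positivity) hle 2
      have hlt : (16 / 9 : ℝ) ^ (k + 1) < (16 / 9 : ℝ) ^ N := by
        have e : ((4 / 3 : ℝ) ^ (k + 1) * γ) ^ 2 = (16 / 9 : ℝ) ^ (k + 1) * γ ^ 2 := by
          rw [mul_pow, ← pow_mul, mul_comm (k + 1) 2, pow_mul]; norm_num
        rw [e] at hsq
        have h3 : 1 < 3 * Real.log M * γ ^ 2 := by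
          rw [div_lt_iff₀ (by positivity)] at hsmall; linarith
        have h169 : 0 < (16 / 9 : ℝ) ^ (k + 1) := by positivity
        nlinarith
      have hkN : k + 1 < N := (pow_lt_pow_iff_right₀ (by norm_num : (1 : ℝ) < 16 / 9)).1 hlt
      have : Real.log M * (k + 1 : ℕ) ≤ Real.log M * N := by
        gcongr
      have hpos : 0 < 1 / γ ^ 2 := by positivity
      push_cast at this ⊢
      linarith

end Counting

/-! ### §3 Depth shells in the fibre coordinate -/

section Shells

/-- For `s > 0` some power `(1/2)^k` lies below `4s/3`. [folklore] -/
theorem exists_half_pow_lt {s : ℝ} (hs : 0 < s) : ∃ k : ℕ, (1 / 2 : ℝ) ^ k < 4 * s / 3 :=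
  exists_pow_lt_of_lt_one (by positivity) (by norm_num)

open Classical in
/-- **Shell index** `kIdx s`: the least `k` with `(1/2)^k < 4s/3` (so `kIdx ((1/2)^k) = k` EXACTLY, no
logarithms); junk value `0` for `s ≤ 0`. -/
def kIdx (s : ℝ) : ℕ := if hs : 0 < s then Nat.find (exists_half_pow_lt hs) else 0

open Classical in
/-- Defining property of the shell index. [folklore] -/
theorem kIdx_spec {s : ℝ} (hs : 0 < s) : (1 / 2 : ℝ) ^ kIdx s < 4 * s / 3 := by
  unfold kIdx; rw [dif_pos hs]; exact Nat.find_spec (exists_half_pow_lt hs)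

open Classical in
/-- Minimality of the shell index. [folklore] -/
theorem kIdx_le_of {s : ℝ} (hs : 0 < s) {k : ℕ} (h : (1 / 2 : ℝ) ^ k < 4 * s / 3) : kIdx s ≤ k := by
  unfold kIdx; rw [dif_pos hs]; exact Nat.find_min' _ h

/-- Lower bound for the shell index. [folklore] -/
theorem le_kIdx_of {s : ℝ} (hs : 0 < s) {k : ℕ} (h : ∀ m < k, 4 * s / 3 ≤ (1 / 2 : ℝ) ^ m) : k ≤ kIdx s := by
  by_contra hlt
  rw [not_le] at hlt
  exact (not_lt.2 (h _ hlt)) (kIdx_spec hs)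

/-- Powers of `1/2` below an index are at least twice the power at the index. [folklore] -/
theorem two_mul_half_pow_le {m k : ℕ} (hmk : m < k) : 2 * (1 / 2 : ℝ) ^ k ≤ (1 / 2 : ℝ) ^ m := by
  have h : (1 / 2 : ℝ) ^ k ≤ (1 / 2 : ℝ) ^ (m + 1) :=
    pow_le_pow_of_le_one (by norm_num) (by norm_num) hmk
  rw [pow_succ] at h
  linarith

/-- The shell index is `k` on the window `(13/16, 5/4)·(1/2)^k` (which contains the shell `(1/2)^k`). [folklore] -/
theorem kIdx_eq_of_window {s : ℝ} {k : ℕ} (h1 : 13 / 16 * (1 / 2 : ℝ) ^ k < s) (h2 : s < 5 / 4 * (1 / 2 : ℝ) ^ k) :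
    kIdx s = k := by
  have hpk : 0 < (1 / 2 : ℝ) ^ k := by positivity
  have hs : 0 < s := lt_trans (by positivity) h1
  refine le_antisymm (kIdx_le_of hs (by linarith)) (le_kIdx_of hs fun m hm => ?_)
  have := two_mul_half_pow_le hm
  linarith

/-- The shell itself: `kIdx ((1/2)^k) = k`. [folklore] -/
theorem kIdx_half_pow (k : ℕ) : kIdx ((1 / 2 : ℝ) ^ k) = k := by
  have hpk : 0 < (1 / 2 : ℝ) ^ k := by positivity
  exact kIdx_eq_of_window (by linarith) (by linarith)

/-- On the gap `(9/16, 7/8)·(1/2)^k` the shell index is `k` or `k+1`. [folklore] -/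
theorem kIdx_mem_of_gap {s : ℝ} {k : ℕ} (h1 : 9 / 16 * (1 / 2 : ℝ) ^ k < s) (h2 : s < 7 / 8 * (1 / 2 : ℝ) ^ k) :
    kIdx s = k ∨ kIdx s = k + 1 := by
  have hpk : 0 < (1 / 2 : ℝ) ^ k := by positivity
  have hs : 0 < s := lt_trans (by positivity) h1
  have hup : kIdx s ≤ k + 1 := kIdx_le_of hs (by rw [pow_succ]; linarith)
  have hlow : k ≤ kIdx s := le_kIdx_of hs fun m hm => by have := two_mul_half_pow_le hm; linarith
  omega

/-- Small `s` forces deep shells: `s < (3/4)(1/2)^k₀ ⇒ k₀ < kIdx s`. [folklore] -/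
theorem lt_kIdx_of_small {s : ℝ} (hs : 0 < s) {k₀ : ℕ} (h : s < 3 / 4 * (1 / 2 : ℝ) ^ k₀) : k₀ < kIdx s := by
  have := le_kIdx_of hs (k := k₀ + 1) fun m hm => by
    have hm' : m ≤ k₀ := Nat.lt_succ_iff.1 hm
    have hpow : (1 / 2 : ℝ) ^ k₀ ≤ (1 / 2 : ℝ) ^ m := pow_le_pow_of_le_one (by norm_num) (by norm_num) hm'
    linarith
  omega

/-- **Shell weight** `Λ(s) = max 0 (1 − 8·|2^{kIdx s} s − 1|)` for `s > 0` (a tent of relative half-width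
`1/8` around each shell `(1/2)^k`, `= 1` exactly on the shell), `0` for `s ≤ 0`. -/
def shellW (s : ℝ) : ℝ := if 0 < s then max 0 (1 - 8 * |2 ^ kIdx s * s - 1|) else 0

/-- `0 ≤ Λ ≤ 1`. [folklore] -/
theorem shellW_mem (s : ℝ) : 0 ≤ shellW s ∧ shellW s ≤ 1 := by
  unfold shellW
  split_ifs
  · exact ⟨le_max_left _ _, max_le zero_le_one (by linarith [abs_nonneg (2 ^ kIdx s * s - 1)])⟩
  · exact ⟨le_rfl, zero_le_one⟩

/-- `Λ = 1` exactly on the shells. [folklore] -/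
theorem shellW_half_pow (k : ℕ) : shellW ((1 / 2 : ℝ) ^ k) = 1 := by
  have hpk : 0 < (1 / 2 : ℝ) ^ k := by positivity
  unfold shellW
  rw [if_pos hpk, kIdx_half_pow, ← mul_pow]
  norm_num

/-- `Λ` vanishes where the relative distance to the indexed shell is at least `1/8`. [folklore] -/
theorem shellW_eq_zero_of {s : ℝ} (h : 1 / 8 ≤ |2 ^ kIdx s * s - 1|) : shellW s = 0 := by
  unfold shellW
  split_ifs
  · exact max_eq_left (by linarith)
  · rfl

/-- `Λ` vanishes on the gaps `(9/16, 7/8)·(1/2)^k`. [folklore] -/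
theorem shellW_eq_zero_of_gap {s : ℝ} {k : ℕ} (h1 : 9 / 16 * (1 / 2 : ℝ) ^ k < s) (h2 : s < 7 / 8 * (1 / 2 : ℝ) ^ k) :
    shellW s = 0 := by
  have hpk : 0 < (1 / 2 : ℝ) ^ k := by positivity
  have h2k : (2 : ℝ) ^ k * (1 / 2 : ℝ) ^ k = 1 := by rw [← mul_pow]; norm_num
  refine shellW_eq_zero_of ?_
  rcases kIdx_mem_of_gap h1 h2 with h | h <;> rw [h]
  · -- 2^k s < 7/8
    have : (2 : ℝ) ^ k * s < 7 / 8 := by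
      have := mul_lt_mul_of_pos_left h2 (show (0 : ℝ) < 2 ^ k by positivity)
      have e : (2 : ℝ) ^ k * (7 / 8 * (1 / 2) ^ k) = 7 / 8 := by linear_combination (7 / 8 : ℝ) * h2k
      linarith
    rw [abs_of_neg (by linarith)]; linarith
  · -- 2^(k+1) s > 9/8
    have : 9 / 8 < (2 : ℝ) ^ (k + 1) * s := by
      have := mul_lt_mul_of_pos_left h1 (show (0 : ℝ) < 2 ^ (k + 1) by positivity)
      have e : (2 : ℝ) ^ (k + 1) * (9 / 16 * (1 / 2) ^ k) = 9 / 8 := by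
        rw [pow_succ]; linear_combination (9 / 8 : ℝ) * h2k
      linarith
    rw [abs_of_pos (by linarith)]; linarith

/-- `Λ` vanishes beyond `9/8`. [folklore] -/
theorem shellW_eq_zero_of_large {s : ℝ} (h : 9 / 8 < s) : shellW s = 0 := by
  have hs : 0 < s := by linarith
  have hk : kIdx s = 0 := le_antisymm (kIdx_le_of hs (by simp; linarith)) (Nat.zero_le _)
  refine shellW_eq_zero_of ?_
  rw [hk, pow_zero, one_mul, abs_of_pos (by linarith)]; linarith

/-- On the window `(13/16, 5/4)·(1/2)^k` the weight is the explicit `k`-th tent. [folklore] -/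
theorem shellW_eq_of_window {s : ℝ} {k : ℕ} (h1 : 13 / 16 * (1 / 2 : ℝ) ^ k < s) (h2 : s < 5 / 4 * (1 / 2 : ℝ) ^ k) :
    shellW s = max 0 (1 - 8 * |2 ^ k * s - 1|) := by
  have hs : 0 < s := lt_trans (by positivity) h1
  unfold shellW; rw [if_pos hs, kIdx_eq_of_window h1 h2]

/-- Every `s ∈ (0, 5/4)` lies in some dyadic band `(9/16, 5/4)·(1/2)^k` (window ∪ gap). [folklore] -/
theorem exists_band {s : ℝ} (hs : 0 < s) (hs' : s < 5 / 4) :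
    ∃ k : ℕ, 9 / 16 * (1 / 2 : ℝ) ^ k < s ∧ s < 5 / 4 * (1 / 2 : ℝ) ^ k := by
  classical
  have hex : ∃ k : ℕ, (1 / 2 : ℝ) ^ k < 16 * s / 9 := exists_pow_lt_of_lt_one (by positivity) (by norm_num)
  refine ⟨Nat.find hex, ?_, ?_⟩
  · have := Nat.find_spec hex; linarith
  · rcases Nat.eq_zero_or_pos (Nat.find hex) with h0 | hpos
    · rw [h0, pow_zero]; linarith
    · have hmin := Nat.find_min hex (Nat.sub_one_lt_of_lt hpos)
      rw [not_lt] at hmin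
      have e : (1 / 2 : ℝ) ^ (Nat.find hex - 1) = 2 * (1 / 2 : ℝ) ^ Nat.find hex := by
        conv_rhs => rw [show Nat.find hex = Nat.find hex - 1 + 1 by omega, pow_succ]
        ring
      rw [e] at hmin
      linarith

end Shells

/-! ### §4a Definitions of the germ and of the realisation functional (theorems in part II) -/

section GermDefs

variable {G : Type} [Group G] [TopologicalSpace G] [IsTopologicalGroup G] [CompactSpace G]
  [MeasurableSpace G] [BorelSpace G] (r : LatticeRep G) (M : ℕ) (κ : ℝ)

/-- Clamp to `[0, 1]`. -/
def clampU (t : ℝ) : ℝ := max 0 (min t 1)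

/-- Tent at `0` of half-width `1`. -/
def tentZ (u : ℝ) : ℝ := max 0 (1 - |u|)

/-- **Decoded coupling** of a thin-chart point `(x, (s, w))`: `clamp(w/s)` — on the junk Wilson orbit
`(φ^k g, 2^{-k}, 2^{-k} g)` this is exactly `g`. -/
def γOf (q : ℝ × (ℝ × ℝ)) : ℝ := clampU (q.2.2 / q.2.1)

/-- **Transported pure-curvature Wilson data** at depth `k` on the base torus `S₀`: the genuine centred
curvature `n`-point function at inverse coupling `β` on the torus `M^k S₀` with `k`-fold dilated test
functions. -/
def dataW (S₀ n : ℕ) (h : Fin n → 𝓢(EuclideanSpace ℝ (Fin 4), ℝ)) (k : ℕ) (β : ℝ) : ℝ :=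
  wilsonCentredSchwinger r.ρ β ((M ^ k * S₀ - 1) / 2) (fun _ => 1) n (fun _ => r.curvature)
    (fun i => (blockDilate M)^[k] (h i))

/-- The data read through the dictionary `β = κ/γ²` of the decoded coupling (`0` for `γ ≤ 0`). -/
def Efn (S₀ n : ℕ) (h : Fin n → 𝓢(EuclideanSpace ℝ (Fin 4), ℝ)) (k : ℕ) (γ : ℝ) : ℝ :=
  if 0 < γ then dataW r M S₀ n h k (κ / γ ^ 2) else 0

open Classical in
/-- **The continuous germ** of the over-tuned thin inhabitant on base tori `S₀`: zero on mixed species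
strings and on even/zero base tori, `1` for the `0`-point function, and otherwise
`Λ(s) · ζ(x − φ^{k(s)}(γ)) · E_{k(s)}(γ)` — shell weight × orbit localiser × transported data. -/
def germC (n : ℕ) (σ : Fin n → YMSpecies G) (q : ℝ × (ℝ × ℝ)) (S₀ : ℕ)
    (h : Fin n → 𝓢(EuclideanSpace ℝ (Fin 4), ℝ)) : ℝ :=
  if (∀ i, σ i = r.curvature) then
    if Odd S₀ then
      if n = 0 then 1
      else shellW q.2.1 * tentZ (q.1 - (φJ M)^[kIdx q.2.1] (γOf q)) * Efn r M κ S₀ n h (kIdx q.2.1) (γOf q)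
    else 0
  else 0

variable (hM : 2 ≤ M)

/-- The realisation functional of the over-tuned thin inhabitant (orbit recursion over the germ). -/
def expectC (n : ℕ) (σ : Fin n → YMSpecies G) (p : ℝ × (ℝ × ℝ)) (S : ℕ)
    (f : Fin n → 𝓢(EuclideanSpace ℝ (Fin 4), ℝ)) : ℝ :=
  orbitRec M (FJ M) (contractTuple M) (germC r M κ n σ) hM p S f

/-- The main branch of the germ. -/
def germMain (S₀ n : ℕ) (h : Fin n → 𝓢(EuclideanSpace ℝ (Fin 4), ℝ)) (q : ℝ × (ℝ × ℝ)) : ℝ :=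
  shellW q.2.1 * tentZ (q.1 - (φJ M)^[kIdx q.2.1] (γOf q)) * Efn r M κ S₀ n h (kIdx q.2.1) (γOf q)

/-- The main branch on the window of shell `k`: the explicit `k`-th expression. -/
def germWin (S₀ n : ℕ) (h : Fin n → 𝓢(EuclideanSpace ℝ (Fin 4), ℝ)) (k : ℕ) (q : ℝ × (ℝ × ℝ)) : ℝ :=
  max 0 (1 - 8 * |2 ^ k * q.2.1 - 1|) * tentZ (q.1 - (φJ M)^[k] (γOf q)) * Efn r M κ S₀ n h k (γOf q)

end GermDefs

end

noncomputable section

/-! ### §4 The continuous germ of the over-tuned thin inhabitant -/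

section Germ

variable {G : Type} [Group G] [TopologicalSpace G] [IsTopologicalGroup G] [CompactSpace G]
  [MeasurableSpace G] [BorelSpace G] (r : LatticeRep G) (M : ℕ) (κ : ℝ)

/-- `clampU t ∈ [0, 1]`. [folklore] -/
theorem clampU_mem (t : ℝ) : 0 ≤ clampU t ∧ clampU t ≤ 1 :=
  ⟨le_max_left _ _, max_le zero_le_one (min_le_right _ _)⟩

/-- `clampU` is the identity on `[0, 1]`. [folklore] -/
theorem clampU_of_mem {t : ℝ} (h0 : 0 ≤ t) (h1 : t ≤ 1) : clampU t = t := by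
  unfold clampU; rw [min_eq_left h1, max_eq_right h0]

/-- `clampU t = 0` for `t ≤ 0`. [folklore] -/
theorem clampU_of_nonpos {t : ℝ} (h : t ≤ 0) : clampU t = 0 := by
  unfold clampU; exact max_eq_left ((min_le_left _ _).trans h)

/-- `clampU t = 1` for `t ≥ 1`. [folklore] -/
theorem clampU_of_one_le {t : ℝ} (h : 1 ≤ t) : clampU t = 1 := by
  unfold clampU; rw [min_eq_right h, max_eq_right zero_le_one]

/-- `clampU` is continuous. [folklore] -/
theorem continuous_clampU : Continuous clampU := by unfold clampU; fun_prop

/-- `tentZ u ∈ [0, 1]`. [folklore] -/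
theorem tentZ_mem (u : ℝ) : 0 ≤ tentZ u ∧ tentZ u ≤ 1 :=
  ⟨le_max_left _ _, max_le zero_le_one (by linarith [abs_nonneg u])⟩

/-- `tentZ 0 = 1`. [folklore] -/
@[simp] theorem tentZ_zero : tentZ 0 = 1 := by simp [tentZ]

/-- `tentZ u = 0` for `|u| ≥ 1`. [folklore] -/
theorem tentZ_eq_zero {u : ℝ} (h : 1 ≤ |u|) : tentZ u = 0 := by
  unfold tentZ; exact max_eq_left (by linarith)

/-- `tentZ` is continuous. [folklore] -/
theorem continuous_tentZ : Continuous tentZ := by unfold tentZ; fun_prop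

/-- `γOf q ∈ [0, 1]`. [folklore] -/
theorem γOf_mem (q : ℝ × (ℝ × ℝ)) : 0 ≤ γOf q ∧ γOf q ≤ 1 := clampU_mem _

/-- **The germ at an orbit point of a junk Wilson point** returns exactly the Wilson data (4b) demands
(read with normalisations `cInd`). [folklore] -/
theorem germC_orbit (n : ℕ) (σ : Fin n → YMSpecies G) {g : ℝ} (hg : g ∈ Set.Ioc (0 : ℝ) 1)
    (k S₀ : ℕ) (h : Fin n → 𝓢(EuclideanSpace ℝ (Fin 4), ℝ)) :
    germC r M κ n σ ((FJ M)^[k] (g, ((1 : ℝ), g))) S₀ h =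
      if Odd S₀ then
        wilsonCentredSchwinger r.ρ (κ / g ^ 2) ((M ^ k * S₀ - 1) / 2) (cInd r) n σ
          (fun i => (blockDilate M)^[k] (h i))
      else 0 := by
  classical
  rw [FJ_iterate]
  have hpk : 0 < (1 / 2 : ℝ) ^ k := by positivity
  have hγ : γOf ((φJ M)^[k] g, (1 / 2 : ℝ) ^ k, (1 / 2 : ℝ) ^ k * g) = g := by
    unfold γOf
    simp only
    rw [mul_div_cancel_left₀ g hpk.ne', clampU_of_mem hg.1.le hg.2]
  unfold germC
  simp only
  rw [kIdx_half_pow, shellW_half_pow, hγ, sub_self, tentZ_zero, one_mul, one_mul]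
  by_cases hσ : ∀ i, σ i = r.curvature
  · rw [if_pos hσ]
    by_cases hodd : Odd S₀
    · rw [if_pos hodd, if_pos hodd, wilsonCentredSchwinger_cInd, if_pos hσ]
      cases n with
      | zero =>
        rw [if_pos rfl, wilsonCentredSchwinger_zero]
        haveI := isProbabilityMeasure_wilsonMeasure (d := 4) (L := 2 * ((M ^ k * S₀ - 1) / 2) + 1) r.ρ
          r.continuous (κ / g ^ 2)
        exact probReal_univ.symm
      | succ m =>
        rw [if_neg (Nat.succ_ne_zero m)]
        unfold Efn dataW
        rw [if_pos hg.1]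
    · rw [if_neg hodd, if_neg hodd]
  · rw [if_neg hσ]
    by_cases hodd : Odd S₀
    · rw [if_pos hodd, wilsonCentredSchwinger_cInd, if_neg hσ]
    · rw [if_neg hodd]

variable (hM : 2 ≤ M)

/-- (4a) holds identically. [folklore] -/
theorem expectC_step (n : ℕ) (σ : Fin n → YMSpecies G) (p : ℝ × (ℝ × ℝ)) (S : ℕ)
    (f : Fin n → 𝓢(EuclideanSpace ℝ (Fin 4), ℝ)) :
    expectC r M κ hM n σ (FJ M p) S f =
      expectC r M κ hM n σ p (M * S) (fun i => blockDilate M (f i)) := by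
  have hM0 : M ≠ 0 := by omega
  by_cases hS : S = 0
  · subst hS
    unfold expectC
    rw [mul_zero, orbitRec_of_not _ _ _ hM _ 0 _ (by simp), orbitRec_of_not _ _ _ hM _ 0 _ (by simp)]
    have h0 : ∀ (q : ℝ × (ℝ × ℝ)) (h : Fin n → 𝓢(EuclideanSpace ℝ (Fin 4), ℝ)),
        germC r M κ n σ q 0 h = 0 := by
      intro q h
      unfold germC
      rw [if_neg (by decide : ¬ Odd 0)]
      split_ifs <;> rfl
    rw [h0, h0]
  · unfold expectC
    rw [orbitRec_mul _ _ _ hM p hS]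
    congr 1
    funext i
    exact (blockContract_blockDilate hM0 (f i)).symm

/-- **Orbit values**: at depth `k` of the orbit of `(g, (1, g))`, on the torus `S'`, the functional
returns the genuine Wilson data on the torus `M^k S'` (when odd; `M` odd) at `β = κ/g²` with `k`-fold
dilated test functions, normalisations `cInd`. [folklore] -/
theorem expectC_orbit (hMo : Odd M) (n : ℕ) (σ : Fin n → YMSpecies G) {g : ℝ}
    (hg : g ∈ Set.Ioc (0 : ℝ) 1) (S' k : ℕ) (h : Fin n → 𝓢(EuclideanSpace ℝ (Fin 4), ℝ)) :
    expectC r M κ hM n σ ((FJ M)^[k] (g, ((1 : ℝ), g))) S' h =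
      if Odd (M ^ k * S') then
        wilsonCentredSchwinger r.ρ (κ / g ^ 2) ((M ^ k * S' - 1) / 2) (cInd r) n σ
          (fun i => (blockDilate M)^[k] (h i))
      else 0 := by
  have hM0 : M ≠ 0 := by omega
  induction S' using Nat.strong_induction_on generalizing k h with
  | _ S' ih =>
    by_cases hdiv : S' ≠ 0 ∧ M ∣ S'
    · obtain ⟨S'', rfl⟩ := hdiv.2
      have hS'' : S'' ≠ 0 := by rintro rfl; exact hdiv.1 (by simp)
      have hlt : S'' < M * S'' := by
        have : 1 * S'' < M * S'' := Nat.mul_lt_mul_of_pos_right (by omega) (Nat.pos_of_ne_zero hS'')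
        simpa using this
      unfold expectC
      rw [orbitRec_mul _ _ _ hM _ hS'', ← Function.iterate_succ_apply' (FJ M) k]
      have := ih S'' hlt (k + 1) (contractTuple M h)
      unfold expectC at this
      rw [this]
      have hpow : M ^ (k + 1) * S'' = M ^ k * (M * S'') := by ring
      have hfun : (fun i => (blockDilate M)^[k + 1] (contractTuple M h i)) =
          fun i => (blockDilate M)^[k] (h i) := by
        funext i
        rw [Function.iterate_succ_apply]
        simp [contractTuple, blockDilate_blockContract hM0]
      rw [hpow, hfun]
    · unfold expectC
      rw [orbitRec_of_not _ _ _ hM _ _ _ hdiv, germC_orbit r M κ n σ hg k S' h]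
      have hiff : Odd S' ↔ Odd (M ^ k * S') := by
        rw [Nat.odd_mul]
        exact ⟨fun h => ⟨hMo.pow, h⟩, fun h => h.2⟩
      simp only [hiff]

/-- (4b): at the junk Wilson point `(g, (1, g))` on the odd torus `2L+1` the functional IS Wilson's
centred `n`-point function at `β = κ/g²` with normalisations `cInd`. [folklore] -/
theorem expectC_wilson (hMo : Odd M) (n : ℕ) (σ : Fin n → YMSpecies G) {g : ℝ}
    (hg : g ∈ Set.Ioc (0 : ℝ) 1) (L : ℕ) (f : Fin n → 𝓢(EuclideanSpace ℝ (Fin 4), ℝ)) :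
    expectC r M κ hM n σ (g, ((1 : ℝ), g)) (2 * L + 1) f =
      wilsonCentredSchwinger r.ρ (κ / g ^ 2) L (cInd r) n σ f := by
  have h := expectC_orbit r M κ hM hMo n σ hg (2 * L + 1) 0 f
  simp only [Function.iterate_zero, id_eq, pow_zero, one_mul] at h
  rw [h, if_pos ⟨L, rfl⟩]
  congr 1
  omega

/-- The junk step is continuous. [folklore] -/
theorem continuous_FJ : Continuous (FJ M) := by unfold FJ φJ; fun_prop

/-- From `1` the junk flow escapes to infinity at least linearly: `1 + k b ≤ φ^k(1)`. [folklore] -/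
theorem iterate_φJ_one_ge (hb : 0 ≤ Real.log M) (k : ℕ) : 1 + k * Real.log M ≤ (φJ M)^[k] 1 := by
  induction k with
  | zero => simp
  | succ k ih =>
    rw [Function.iterate_succ_apply']
    set y := (φJ M)^[k] 1 with hy
    have h0 : (0 : ℝ) ≤ k * Real.log M := by positivity
    have hy1 : 1 ≤ y := by linarith
    have hy3 : 1 ≤ y ^ 3 := one_le_pow₀ hy1
    have : y + Real.log M ≤ φJ M y := by
      unfold φJ; nlinarith
    push_cast; linarith

end Germ

end

noncomputable section

/-! ### §5 Continuity of the germ modulo uniform over-tuned triviality -/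

section Continuity

variable {G : Type} [Group G] [TopologicalSpace G] [IsTopologicalGroup G] [CompactSpace G]
  [MeasurableSpace G] [BorelSpace G] (r : LatticeRep G) (M : ℕ) (κ : ℝ)

/-- The transported data on a fixed depth shell tend to `0` as `β → ∞` (finite-torus regularity). [folklore] -/
theorem tendsto_dataW_atTop (S₀ m : ℕ) (h : Fin (m + 1) → 𝓢(EuclideanSpace ℝ (Fin 4), ℝ)) (k : ℕ) :
    Tendsto (dataW r M S₀ (m + 1) h k) atTop (𝓝 0) := by
  unfold dataW
  obtain ⟨Kc, hKc⟩ := abs_curvCorr_le r ((M ^ k * S₀ - 1) / 2) m (fun i => (blockDilate M)^[k] (h i))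
  have hT := (tendsto_expect_wilsonAction r (2 * ((M ^ k * S₀ - 1) / 2) + 1)).const_mul Kc
  rw [mul_zero] at hT
  exact squeeze_zero_norm (fun β => by rw [Real.norm_eq_abs]; exact hKc β) hT

/-- The transported data on a fixed depth shell are continuous in `β`. [folklore] -/
theorem continuous_dataW (S₀ n : ℕ) (h : Fin n → 𝓢(EuclideanSpace ℝ (Fin 4), ℝ)) (k : ℕ) :
    Continuous (dataW r M S₀ n h k) := by
  unfold dataW
  exact continuous_wilsonCentredSchwinger r _ _ _ _

/-- **`E_k` is continuous on `ℝ`** (`κ > 0`, `n ≥ 1`): continuous in `γ > 0` through `β = κ/γ²`, zero for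
`γ ≤ 0`, and `→ 0` as `γ → 0⁺` because `β → ∞` on a fixed torus. [folklore] -/
theorem continuous_Efn (hκ : 0 < κ) (S₀ m : ℕ) (h : Fin (m + 1) → 𝓢(EuclideanSpace ℝ (Fin 4), ℝ)) (k : ℕ) :
    Continuous (Efn r M κ S₀ (m + 1) h k) := by
  have hW := continuous_dataW r M S₀ (m + 1) h k
  have hT := tendsto_dataW_atTop r M S₀ m h k
  rw [continuous_iff_continuousAt]
  intro γ₀
  rcases lt_trichotomy γ₀ 0 with hneg | hzero | hpos
  · have hev : (Efn r M κ S₀ (m + 1) h k) =ᶠ[𝓝 γ₀] fun _ => 0 := by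
      filter_upwards [Iio_mem_nhds hneg] with γ hγ
      simp [Efn, not_lt.2 (le_of_lt (Set.mem_Iio.1 hγ))]
    exact continuousAt_const.congr_of_eventuallyEq hev
  · subst hzero
    have h0 : Efn r M κ S₀ (m + 1) h k 0 = 0 := by simp [Efn]
    rw [continuousAt_iff_continuous_left'_right']
    constructor
    · refine (continuousWithinAt_const (b := (0 : ℝ))).congr (fun γ hγ => ?_) h0
      simp [Efn, not_lt.2 (le_of_lt (Set.mem_Iio.1 hγ))]
    · unfold ContinuousWithinAt
      rw [h0]
      have hdiv : Tendsto (fun γ : ℝ => κ / γ ^ 2) (𝓝[>] 0) atTop := by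
        have h1 : Tendsto (fun γ : ℝ => γ ^ 2) (𝓝[>] (0 : ℝ)) (𝓝[>] 0) := by
          refine tendsto_nhdsWithin_iff.2 ⟨?_, ?_⟩
          · have : Tendsto (fun γ : ℝ => γ ^ 2) (𝓝 (0 : ℝ)) (𝓝 0) := by
              simpa using ((continuous_pow 2).tendsto (0 : ℝ))
            exact this.mono_left nhdsWithin_le_nhds
          · filter_upwards [self_mem_nhdsWithin] with γ hγ using pow_pos (Set.mem_Ioi.1 hγ) 2
        have h2 := (tendsto_inv_nhdsGT_zero.comp h1).const_mul_atTop hκ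
        refine h2.congr fun γ => ?_
        simp [div_eq_mul_inv]
      refine (hT.comp hdiv).congr' ?_
      filter_upwards [self_mem_nhdsWithin] with γ hγ
      simp [Efn, Set.mem_Ioi.1 hγ]
  · have hev : (Efn r M κ S₀ (m + 1) h k) =ᶠ[𝓝 γ₀] fun γ => dataW r M S₀ (m + 1) h k (κ / γ ^ 2) := by
      filter_upwards [Ioi_mem_nhds hpos] with γ hγ
      simp [Efn, Set.mem_Ioi.1 hγ]
    refine ContinuousAt.congr_of_eventuallyEq ?_ hev
    have hne : γ₀ ^ 2 ≠ 0 := by positivity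
    exact hW.continuousAt.comp (continuousAt_const.div (continuousAt_id.pow 2) hne)

/-- The decoded coupling is continuous off `s = 0`. [folklore] -/
theorem continuousAt_γOf {q₀ : ℝ × (ℝ × ℝ)} (hs : q₀.2.1 ≠ 0) : ContinuousAt γOf q₀ := by
  unfold γOf
  refine continuous_clampU.continuousAt.comp ?_
  exact ((continuous_snd.comp continuous_snd).continuousAt).div
    ((continuous_fst.comp continuous_snd).continuousAt) hs

/-- Component bounds from a bound on the sup distance in `ℝ × (ℝ × ℝ)`. [folklore] -/
theorem abs_sub_lt_of_dist_lt {q q₀ : ℝ × (ℝ × ℝ)} {δ : ℝ} (hq : dist q q₀ < δ) :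
    |q.1 - q₀.1| < δ ∧ |q.2.1 - q₀.2.1| < δ ∧ |q.2.2 - q₀.2.2| < δ := by
  rw [Prod.dist_eq, Prod.dist_eq] at hq
  refine ⟨?_, ?_, ?_⟩
  · exact lt_of_le_of_lt (by rw [← Real.dist_eq]; exact le_max_left _ _) hq
  · exact lt_of_le_of_lt (by rw [← Real.dist_eq]; exact (le_max_left _ _).trans (le_max_right _ _)) hq
  · exact lt_of_le_of_lt (by rw [← Real.dist_eq]; exact (le_max_right _ _).trans (le_max_right _ _)) hq

/-- The main branch is dominated by its data factor. [folklore] -/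
theorem abs_germMain_le (S₀ n : ℕ) (h : Fin n → 𝓢(EuclideanSpace ℝ (Fin 4), ℝ)) (q : ℝ × (ℝ × ℝ)) :
    |germMain r M κ S₀ n h q| ≤ |Efn r M κ S₀ n h (kIdx q.2.1) (γOf q)| := by
  unfold germMain
  rw [abs_mul, abs_mul, abs_of_nonneg (shellW_mem _).1, abs_of_nonneg (tentZ_mem _).1]
  have h1 := (shellW_mem q.2.1).2
  have h2 := (tentZ_mem (q.1 - (φJ M)^[kIdx q.2.1] (γOf q))).2
  have h3 := abs_nonneg (Efn r M κ S₀ n h (kIdx q.2.1) (γOf q))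
  calc shellW q.2.1 * tentZ (q.1 - (φJ M)^[kIdx q.2.1] (γOf q)) * |Efn r M κ S₀ n h (kIdx q.2.1) (γOf q)|
      ≤ 1 * 1 * |Efn r M κ S₀ n h (kIdx q.2.1) (γOf q)| := by
        apply mul_le_mul_of_nonneg_right _ h3
        exact mul_le_mul h1 h2 (tentZ_mem _).1 zero_le_one
    _ = _ := by ring

/-- On the window `(13/16, 5/4)·(1/2)^k` the main branch IS the `k`-th expression. [folklore] -/
theorem germMain_eq_germWin {S₀ n : ℕ} {h : Fin n → 𝓢(EuclideanSpace ℝ (Fin 4), ℝ)} {k : ℕ}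
    {q : ℝ × (ℝ × ℝ)} (h1 : 13 / 16 * (1 / 2 : ℝ) ^ k < q.2.1) (h2 : q.2.1 < 5 / 4 * (1 / 2 : ℝ) ^ k) :
    germMain r M κ S₀ n h q = germWin r M κ S₀ n h k q := by
  unfold germMain germWin
  rw [shellW_eq_of_window h1 h2, kIdx_eq_of_window h1 h2]

/-- The `k`-th expression is continuous off `s = 0` (`κ > 0`, `n ≥ 1`). [folklore] -/
theorem continuousAt_germWin (hκ : 0 < κ) (S₀ m : ℕ) (h : Fin (m + 1) → 𝓢(EuclideanSpace ℝ (Fin 4), ℝ))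
    (k : ℕ) {q₀ : ℝ × (ℝ × ℝ)} (hs : q₀.2.1 ≠ 0) : ContinuousAt (germWin r M κ S₀ (m + 1) h k) q₀ := by
  have hγ := continuousAt_γOf hs
  unfold germWin
  refine (ContinuousAt.mul ?_ ?_).mul ?_
  · exact (by fun_prop : Continuous fun q : ℝ × (ℝ × ℝ) => max 0 (1 - 8 * |2 ^ k * q.2.1 - 1|)).continuousAt
  · exact continuous_tentZ.continuousAt.comp
      (continuous_fst.continuousAt.sub (((continuous_φJ M).iterate k).continuousAt.comp hγ))
  · exact (continuous_Efn r M κ hκ S₀ m h k).continuousAt.comp hγ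

/-- **Continuity of the main branch** modulo uniform over-tuned triviality at slope `B = κ log M`
for the (off-diagonal) tuple in hand. [folklore] -/
theorem continuous_germMain (hM : 2 ≤ M) (hκ : 0 < κ) (S₀ m : ℕ)
    (h : Fin (m + 1) → 𝓢(EuclideanSpace ℝ (Fin 4), ℝ))
    (hUOT : ∀ (B' ε : ℝ), 0 < ε → ∃ k₀ : ℕ, ∀ k ≥ k₀, ∀ β : ℝ, κ * Real.log M * k - B' ≤ β →
      |dataW r M S₀ (m + 1) h k β| ≤ ε) :
    Continuous (germMain r M κ S₀ (m + 1) h) := by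
  have hlog : 0 < Real.log M := Real.log_pos (by exact_mod_cast hM)
  rw [continuous_iff_continuousAt]
  rintro ⟨x₀, s₀, w₀⟩
  rcases lt_trichotomy s₀ 0 with hneg | hzero | hpos
  · -- s < 0 : locally zero
    have hev : germMain r M κ S₀ (m + 1) h =ᶠ[𝓝 (x₀, s₀, w₀)] fun _ => 0 := by
      have hopen : IsOpen {q : ℝ × (ℝ × ℝ) | q.2.1 < 0} :=
        isOpen_lt (continuous_fst.comp continuous_snd) continuous_const
      filter_upwards [hopen.mem_nhds (by exact hneg)] with q hq
      have : shellW q.2.1 = 0 := by unfold shellW; rw [if_neg (not_lt.2 (le_of_lt hq))]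
      simp [germMain, this]
    exact continuousAt_const.congr_of_eventuallyEq hev
  · -- s = 0 : the accumulation plane
    subst hzero
    have hval : germMain r M κ S₀ (m + 1) h (x₀, 0, w₀) = 0 := by
      have : shellW (0 : ℝ) = 0 := by unfold shellW; rw [if_neg (lt_irrefl 0)]
      simp [germMain, this]
    rw [Metric.continuousAt_iff]
    intro ε hε
    rcases lt_trichotomy w₀ 0 with hwneg | hwzero | hwpos
    · -- w₀ < 0 : decoded coupling is 0 nearby
      refine ⟨-w₀ / 2, by linarith, fun q hq => ?_⟩
      obtain ⟨-, hs, hw⟩ := abs_sub_lt_of_dist_lt hq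
      rw [hval, dist_zero_right]
      simp only [sub_zero] at hs
      have hw' : q.2.2 < w₀ / 2 := by linarith [(abs_lt.1 hw).2]
      by_cases hqs : q.2.1 ≤ 0
      · have : shellW q.2.1 = 0 := by unfold shellW; rw [if_neg (not_lt.2 hqs)]
        simp [germMain, this, hε]
      · rw [not_le] at hqs
        have hγ : γOf q = 0 := clampU_of_nonpos (div_nonpos_of_nonpos_of_nonneg (by linarith) hqs.le)
        have : Efn r M κ S₀ (m + 1) h (kIdx q.2.1) (γOf q) = 0 := by rw [hγ]; simp [Efn]
        simp [germMain, this, hε]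
    · -- w₀ = 0 : over-tuned data, small by UOT
      subst hwzero
      set T : ℝ := |x₀| + 2 with hT
      obtain ⟨N, hN⟩ := pow_unbounded_of_one_lt (3 * Real.log M * T ^ 2) (by norm_num : (1 : ℝ) < 16 / 9)
      obtain ⟨k₀, hk₀⟩ := hUOT (κ * Real.log M * N) (ε / 2) (by positivity)
      refine ⟨min 1 (3 / 4 * (1 / 2 : ℝ) ^ k₀), lt_min one_pos (by positivity), fun q hq => ?_⟩
      obtain ⟨hx, hs, -⟩ := abs_sub_lt_of_dist_lt hq
      rw [hval, dist_zero_right]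
      simp only [sub_zero] at hs
      by_cases hqs : q.2.1 ≤ 0
      · have : shellW q.2.1 = 0 := by unfold shellW; rw [if_neg (not_lt.2 hqs)]
        simp [germMain, this, hε]
      rw [not_le] at hqs
      have hk : k₀ < kIdx q.2.1 := lt_kIdx_of_small hqs ((abs_lt.1 hs).2.trans_le (min_le_right _ _))
      by_cases hγ0 : 0 < γOf q
      swap
      · have : Efn r M κ S₀ (m + 1) h (kIdx q.2.1) (γOf q) = 0 := by simp [Efn, hγ0]
        simp [germMain, this, hε]
      by_cases htent : 1 ≤ |q.1 - (φJ M)^[kIdx q.2.1] (γOf q)|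
      · simp [germMain, tentZ_eq_zero htent, hε]
      rw [not_le] at htent
      refine lt_of_le_of_lt (abs_germMain_le r M κ S₀ (m + 1) h q) ?_
      -- the orbit has not passed `T`, so the decoded coupling is over-tuned for its depth
      have hxT : (φJ M)^[kIdx q.2.1] (γOf q) ≤ T := by
        have hx1 : |q.1 - x₀| < 1 := hx.trans_le (min_le_left _ _)
        have h1 := (abs_lt.1 htent).1
        have h2 := (abs_lt.1 hx1).2
        rw [hT]; linarith [le_abs_self x₀]
      have hcount := counting_φJ M hlog hN (kIdx q.2.1) (γOf q) hγ0 hxT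
      have hβ : κ * Real.log M * (kIdx q.2.1) - κ * Real.log M * N ≤ κ / (γOf q) ^ 2 := by
        have h1 := mul_le_mul_of_nonneg_left hcount hκ.le
        have e : κ * (1 / γOf q ^ 2 + Real.log M * N) = κ / γOf q ^ 2 + κ * Real.log M * N := by ring
        rw [e] at h1
        linarith
      have hdat := hk₀ (kIdx q.2.1) hk.le (κ / (γOf q) ^ 2) hβ
      have hE : Efn r M κ S₀ (m + 1) h (kIdx q.2.1) (γOf q) =
          dataW r M S₀ (m + 1) h (kIdx q.2.1) (κ / (γOf q) ^ 2) := by simp [Efn, hγ0]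
      rw [hE]
      linarith
    · -- w₀ > 0 : decoded coupling is 1 nearby and the localiser is off (φ^k(1) → ∞)
      obtain ⟨k₁, hk₁⟩ := exists_nat_gt ((|x₀| + 2) / Real.log M)
      refine ⟨min 1 (min (w₀ / 2) (3 / 4 * (1 / 2 : ℝ) ^ k₁)), lt_min one_pos (lt_min (by linarith) (by positivity)),
        fun q hq => ?_⟩
      obtain ⟨hx, hs, hw⟩ := abs_sub_lt_of_dist_lt hq
      rw [hval, dist_zero_right]
      simp only [sub_zero] at hs
      by_cases hqs : q.2.1 ≤ 0
      · have : shellW q.2.1 = 0 := by unfold shellW; rw [if_neg (not_lt.2 hqs)]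
        simp [germMain, this, hε]
      rw [not_le] at hqs
      have hδw : min 1 (min (w₀ / 2) (3 / 4 * (1 / 2 : ℝ) ^ k₁)) ≤ w₀ / 2 := (min_le_right _ _).trans (min_le_left _ _)
      have hs' : q.2.1 < w₀ / 2 := (abs_lt.1 hs).2.trans_le hδw
      have hw' : w₀ / 2 < q.2.2 := by linarith [(abs_lt.1 hw).1]
      have hγ : γOf q = 1 := by
        refine clampU_of_one_le ?_
        rw [le_div_iff₀ hqs]; linarith
      have hk : k₁ < kIdx q.2.1 :=
        lt_kIdx_of_small hqs ((abs_lt.1 hs).2.trans_le ((min_le_right _ _).trans (min_le_right _ _)))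
      have hbig : |x₀| + 2 < (φJ M)^[kIdx q.2.1] 1 := by
        have h1 : |x₀| + 2 < 1 + k₁ * Real.log M := by
          rw [div_lt_iff₀ hlog] at hk₁; linarith
        have h2 := iterate_φJ_one_ge M hlog.le k₁
        have h3 := iterate_φJ_mono M hlog.le zero_le_one hk.le
        linarith
      have htent : tentZ (q.1 - (φJ M)^[kIdx q.2.1] (γOf q)) = 0 := by
        refine tentZ_eq_zero ?_
        rw [hγ]
        have hx' : q.1 < x₀ + 1 := by linarith [(abs_lt.1 hx).2, min_le_left (1 : ℝ) (min (w₀ / 2) (3 / 4 * (1 / 2 : ℝ) ^ k₁))]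
        rw [abs_of_neg (by linarith [le_abs_self x₀])]
        linarith [le_abs_self x₀]
      simp [germMain, htent, hε]
  · -- s > 0 : dyadic cover
    by_cases hlarge : 9 / 8 < s₀
    · have hev : germMain r M κ S₀ (m + 1) h =ᶠ[𝓝 (x₀, s₀, w₀)] fun _ => 0 := by
        have hopen : IsOpen {q : ℝ × (ℝ × ℝ) | 9 / 8 < q.2.1} :=
          isOpen_lt continuous_const (continuous_fst.comp continuous_snd)
        filter_upwards [hopen.mem_nhds (by exact hlarge)] with q hq
        simp [germMain, shellW_eq_zero_of_large hq]
      exact continuousAt_const.congr_of_eventuallyEq hev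
    · rw [not_lt] at hlarge
      obtain ⟨k, hk1, hk2⟩ := exists_band hpos (lt_of_le_of_lt hlarge (by norm_num))
      by_cases hgap : s₀ < 7 / 8 * (1 / 2 : ℝ) ^ k
      · have hev : germMain r M κ S₀ (m + 1) h =ᶠ[𝓝 (x₀, s₀, w₀)] fun _ => 0 := by
          have hopen : IsOpen {q : ℝ × (ℝ × ℝ) | 9 / 16 * (1 / 2 : ℝ) ^ k < q.2.1 ∧ q.2.1 < 7 / 8 * (1 / 2 : ℝ) ^ k} :=
            (isOpen_lt continuous_const (continuous_fst.comp continuous_snd)).inter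
              (isOpen_lt (continuous_fst.comp continuous_snd) continuous_const)
          filter_upwards [hopen.mem_nhds (by exact ⟨hk1, hgap⟩)] with q hq
          simp [germMain, shellW_eq_zero_of_gap hq.1 hq.2]
        exact continuousAt_const.congr_of_eventuallyEq hev
      · rw [not_lt] at hgap
        have hw1 : 13 / 16 * (1 / 2 : ℝ) ^ k < s₀ := lt_of_lt_of_le (by
          have : (0:ℝ) < (1 / 2 : ℝ) ^ k := by positivity
          nlinarith) hgap
        have hev : germMain r M κ S₀ (m + 1) h =ᶠ[𝓝 (x₀, s₀, w₀)] germWin r M κ S₀ (m + 1) h k := by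
          have hopen : IsOpen {q : ℝ × (ℝ × ℝ) | 13 / 16 * (1 / 2 : ℝ) ^ k < q.2.1 ∧ q.2.1 < 5 / 4 * (1 / 2 : ℝ) ^ k} :=
            (isOpen_lt continuous_const (continuous_fst.comp continuous_snd)).inter
              (isOpen_lt (continuous_fst.comp continuous_snd) continuous_const)
          filter_upwards [hopen.mem_nhds (by exact ⟨hw1, hk2⟩)] with q hq
          exact germMain_eq_germWin r M κ hq.1 hq.2
        exact (continuousAt_germWin r M κ hκ S₀ m h k (by simp; exact hpos.ne')).congr_of_eventuallyEq hev

/-- **Continuity of the germ** (every species string, every base torus, every tuple whose over-tuned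
data decay): constant branches are constant, the main branch is `continuous_germMain`. [folklore] -/
theorem continuous_germC (hM : 2 ≤ M) (hκ : 0 < κ) (n : ℕ) (σ : Fin n → YMSpecies G) (S₀ : ℕ)
    (h : Fin n → 𝓢(EuclideanSpace ℝ (Fin 4), ℝ))
    (hUOT : n ≠ 0 → Odd S₀ → ∀ (B' ε : ℝ), 0 < ε → ∃ k₀ : ℕ, ∀ k ≥ k₀, ∀ β : ℝ,
      κ * Real.log M * k - B' ≤ β → |dataW r M S₀ n h k β| ≤ ε) :
    Continuous fun q => germC r M κ n σ q S₀ h := by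
  classical
  by_cases hσ : ∀ i, σ i = r.curvature
  · by_cases hodd : Odd S₀
    · cases n with
      | zero =>
        have : (fun q => germC r M κ 0 σ q S₀ h) = fun _ => 1 := by
          funext q; unfold germC; rw [if_pos hσ, if_pos hodd, if_pos rfl]
        rw [this]; exact continuous_const
      | succ m =>
        have : (fun q => germC r M κ (m + 1) σ q S₀ h) = germMain r M κ S₀ (m + 1) h := by
          funext q; unfold germC germMain; rw [if_pos hσ, if_pos hodd, if_neg (Nat.succ_ne_zero m)]
        rw [this]
        exact continuous_germMain r M κ hM hκ S₀ m h (hUOT (Nat.succ_ne_zero m) hodd)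
    · have : (fun q => germC r M κ n σ q S₀ h) = fun _ => 0 := by
        funext q; unfold germC; rw [if_pos hσ, if_neg hodd]
      rw [this]; exact continuous_const
  · have : (fun q => germC r M κ n σ q S₀ h) = fun _ => 0 := by
      funext q; unfold germC; rw [if_neg hσ]
    rw [this]; exact continuous_const

end Continuity

end

noncomputable section

/-! ### §1 Off-diagonality is dilation invariant -/

section OffDiag

variable {n : ℕ}

/-- Composing every test function of a tuple with the dilation `x ↦ c • x` (`c ≠ 0`) preserves
off-diagonality of the tensor product: `⁰𝒮` is dilation invariant. [folklore] -/
theorem isOffDiagonal_tensorFin_dilate (f : Fin n → 𝓢(EuclideanSpace ℝ (Fin 4), ℝ)) (c : ℝ)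
    (L : 𝓢(EuclideanSpace ℝ (Fin 4), ℝ) →L[ℝ] 𝓢(EuclideanSpace ℝ (Fin 4), ℝ))
    (hL : ∀ (φ : 𝓢(EuclideanSpace ℝ (Fin 4), ℝ)) (x : EuclideanSpace ℝ (Fin 4)), L φ x = φ (c • x))
    (hf : IsOffDiagonal (SchwartzMap.tensorFin n fun i => ofRealTest (f i))) :
    IsOffDiagonal (SchwartzMap.tensorFin n fun i => ofRealTest (L (f i))) := by
  intro x hx k
  set g : (Fin n → EuclideanSpace ℝ (Fin 4)) →L[ℝ] (Fin n → EuclideanSpace ℝ (Fin 4)) :=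
    c • ContinuousLinearMap.id ℝ _ with hg
  have hfun : ((SchwartzMap.tensorFin n fun i => ofRealTest (L (f i))) :
      (Fin n → EuclideanSpace ℝ (Fin 4)) → ℂ) =
      ((SchwartzMap.tensorFin n fun i => ofRealTest (f i)) : (Fin n → EuclideanSpace ℝ (Fin 4)) → ℂ) ∘ g := by
    funext y
    simp [hL, hg]
  have hgx : g x ∈ coincidenceLocus n (EuclideanSpace ℝ (Fin 4)) := by
    obtain ⟨i, j, hij, hxij⟩ := hx
    exact ⟨i, j, hij, by simp [hg, hxij]⟩
  have hsmooth : ContDiff ℝ k ((SchwartzMap.tensorFin n fun i => ofRealTest (f i)) :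
      (Fin n → EuclideanSpace ℝ (Fin 4)) → ℂ) := SchwartzMap.smooth _ k
  rw [hfun, g.iteratedFDeriv_comp_right hsmooth x le_rfl, hf (g x) hgx k]
  ext v
  simp

/-- Block dilation preserves off-diagonality. [folklore] -/
theorem isOffDiagonal_blockDilate {M : ℕ} (hM : M ≠ 0) (f : Fin n → 𝓢(EuclideanSpace ℝ (Fin 4), ℝ))
    (hf : IsOffDiagonal (SchwartzMap.tensorFin n fun i => ofRealTest (f i))) :
    IsOffDiagonal (SchwartzMap.tensorFin n fun i => ofRealTest (blockDilate M (f i))) :=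
  isOffDiagonal_tensorFin_dilate f ((M : ℝ)⁻¹) (blockDilate M) (fun φ x => blockDilate_apply hM φ x) hf

/-- Block contraction preserves off-diagonality. [folklore] -/
theorem isOffDiagonal_blockContract {M : ℕ} (hM : M ≠ 0) (f : Fin n → 𝓢(EuclideanSpace ℝ (Fin 4), ℝ))
    (hf : IsOffDiagonal (SchwartzMap.tensorFin n fun i => ofRealTest (f i))) :
    IsOffDiagonal (SchwartzMap.tensorFin n fun i => ofRealTest (blockContract M (f i))) :=
  isOffDiagonal_tensorFin_dilate f (M : ℝ) (blockContract M) (fun φ x => blockContract_apply hM φ x) hf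

/-- Iterated block dilation preserves off-diagonality. [folklore] -/
theorem isOffDiagonal_blockDilate_iterate {M : ℕ} (hM : M ≠ 0) (k : ℕ)
    (f : Fin n → 𝓢(EuclideanSpace ℝ (Fin 4), ℝ))
    (hf : IsOffDiagonal (SchwartzMap.tensorFin n fun i => ofRealTest (f i))) :
    IsOffDiagonal (SchwartzMap.tensorFin n fun i => ofRealTest ((blockDilate M)^[k] (f i))) := by
  induction k with
  | zero => simpa using hf
  | succ k ih =>
    have := isOffDiagonal_blockDilate hM (fun i => (blockDilate M)^[k] (f i)) ih
    simpa only [Function.iterate_succ_apply'] using this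

/-- Tuple contraction preserves off-diagonality. [folklore] -/
theorem isOffDiagonal_contractTuple {M : ℕ} (hM : M ≠ 0) (f : Fin n → 𝓢(EuclideanSpace ℝ (Fin 4), ℝ))
    (hf : IsOffDiagonal (SchwartzMap.tensorFin n fun i => ofRealTest (f i))) :
    IsOffDiagonal (SchwartzMap.tensorFin n fun i => ofRealTest (contractTuple M f i)) :=
  isOffDiagonal_blockContract hM f hf

end OffDiag

/-! ### §6 The over-tuned thin inhabitant -/

section Inhabitant

/-- **Orbit recursion preserves continuity along an invariant class of test data** (variant of
`continuous_orbitRec` in which the germ is only known to be continuous for data satisfying a predicate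
stable under the pull-back `T`). [folklore] -/
theorem continuous_orbitRec_of {P α β : Type} (Mb : ℕ) (F : P → P) (T : α → α) (e : P → ℕ → α → β)
    (hMb : 2 ≤ Mb) [TopologicalSpace P] [TopologicalSpace β] (hF : Continuous F) (Q : α → Prop)
    (hQ : ∀ a, Q a → Q (T a)) (he : ∀ S a, Q a → Continuous fun p => e p S a) (S : ℕ) (a : α) (ha : Q a) :
    Continuous fun p => orbitRec Mb F T e hMb p S a := by
  induction S using Nat.strong_induction_on generalizing a with
  | _ S ih =>
    by_cases h : S ≠ 0 ∧ Mb ∣ S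
    · obtain ⟨S', rfl⟩ := h.2
      have hS' : S' ≠ 0 := by rintro rfl; exact h.1 (by simp)
      have hlt : S' < Mb * S' := by
        have : 1 * S' < Mb * S' := Nat.mul_lt_mul_of_pos_right (by omega) (Nat.pos_of_ne_zero hS')
        simpa using this
      simp_rw [orbitRec_mul F T e hMb _ hS']
      exact (ih S' hlt (T a) (hQ a ha)).comp hF
    · simp_rw [orbitRec_of_not F T e hMb _ S _ h]
      exact he S a ha

variable {G : Type} [Group G] [TopologicalSpace G] [IsTopologicalGroup G] [CompactSpace G]
  [MeasurableSpace G] [BorelSpace G] (r : LatticeRep G) (M : ℕ)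

/-- **(4c) for the over-tuned functional.** Under uniform over-tuned triviality at slope `B`, the functional
`expectC` with dictionary constant `κ = B / log M` is continuous in the chart point for every torus, every species
string and every OFF-DIAGONAL tuple (orbit recursion along the dilation-invariant class `⁰𝒮` over the continuous
germ). [folklore] -/
theorem continuous_expectC (hM : 2 ≤ M) {B : ℝ} (hB : 0 < B)
    (hUOT : ∀ (B' : ℝ) (L m : ℕ) (h : Fin (m + 1) → 𝓢(EuclideanSpace ℝ (Fin 4), ℝ)),
      IsOffDiagonal (SchwartzMap.tensorFin (m + 1) fun i => ofRealTest (h i)) →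
      ∀ ε > 0, ∃ k₀ : ℕ, ∀ k ≥ k₀, ∀ β : ℝ, B * k - B' ≤ β →
        |wilsonCentredSchwinger r.ρ β ((M ^ k * (2 * L + 1) - 1) / 2) (fun _ => 1) (m + 1)
          (fun _ => r.curvature) (fun i => (blockDilate M)^[k] (h i))| ≤ ε)
    (n : ℕ) (σ : Fin n → YMSpecies G) (S : ℕ) (f : Fin n → 𝓢(EuclideanSpace ℝ (Fin 4), ℝ))
    (hf : IsOffDiagonal (SchwartzMap.tensorFin n fun i => ofRealTest (f i))) :
    Continuous fun p => expectC r M (B / Real.log M) hM n σ p S f := by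
  have hlog : 0 < Real.log M := Real.log_pos (by exact_mod_cast hM)
  have hκ : 0 < B / Real.log M := div_pos hB hlog
  have hBκ : B / Real.log M * Real.log M = B := by field_simp
  have hM0 : M ≠ 0 := by omega
  refine continuous_orbitRec_of M (FJ M) (contractTuple M) (germC r M (B / Real.log M) n σ) hM
    (continuous_FJ M) (fun a => IsOffDiagonal (SchwartzMap.tensorFin n fun i => ofRealTest (a i)))
    (fun a ha => isOffDiagonal_contractTuple hM0 a ha) (fun S₀ a ha => ?_) S f hf
  refine continuous_germC r M (B / Real.log M) hM hκ n σ S₀ a (fun hn hodd B' ε hε => ?_)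
  obtain ⟨L, rfl⟩ := hodd
  obtain ⟨m, rfl⟩ := Nat.exists_eq_succ_of_ne_zero hn
  obtain ⟨k₀, hk₀⟩ := hUOT B' L m a ha ε hε
  refine ⟨k₀, fun k hk β hβ => ?_⟩
  have hβ' : B * k - B' ≤ β := by rwa [hBκ] at hβ
  exact hk₀ k hk β hβ'

/-- **The over-tuned thin inhabitant.** For ODD `M ≥ 2` (hence `≥ 3`), ANY compact `G` and lattice
representation `r`: if for some slope constant `B > 0` the genuine centred curvature `n`-point Wilson
functions (`n ≥ 1`, unit normalisation, exact centring) on the tori of side `M^k(2L+1)`, smeared with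
`k`-fold block-dilated OFF-DIAGONAL test functions, tend to `0` as `k → ∞` UNIFORMLY over all inverse
couplings `β ≥ B k − B'` (every `B'`) — "uniform over-tuned triviality", an RG-free statement about Wilson's
lattice gauge theory in the deep weak-coupling / small-physical-volume regime — then the crux's structure
`BalabanBanachStep G r M` is inhabited: by the disprover's thin junk chart `ℝ × ℝ²` (`φ g = g + (log M) g³`,
`Ψ = y/2`, `yW g = (1, g)`, `betaOf g = κ/g²` with `κ = B / log M`, normalisations `cInd`) carrying the
CONTINUOUS germ `germC` (shell weight × orbit localiser × transported Wilson data); (4a) by `orbitRec`, (4b)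
by decoding `(k, g)` on the junk Wilson orbits, (4c) by `continuous_expectC` — whose only non-elementary input
at the accumulation plane `s = 0` of the Wilson orbits is the hypothesis. No Banach space of actions, no
renormalisation-group step, no `b₀`, no regulator is involved. [folklore] -/
theorem nonempty_of_uniformOverTuned (hMo : Odd M) (hM : 2 ≤ M) {B : ℝ} (hB : 0 < B)
    (hUOT : ∀ (B' : ℝ) (L m : ℕ) (h : Fin (m + 1) → 𝓢(EuclideanSpace ℝ (Fin 4), ℝ)),
      IsOffDiagonal (SchwartzMap.tensorFin (m + 1) fun i => ofRealTest (h i)) →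
      ∀ ε > 0, ∃ k₀ : ℕ, ∀ k ≥ k₀, ∀ β : ℝ, B * k - B' ≤ β →
        |wilsonCentredSchwinger r.ρ β ((M ^ k * (2 * L + 1) - 1) / 2) (fun _ => 1) (m + 1)
          (fun _ => r.curvature) (fun i => (blockDilate M)^[k] (h i))| ≤ ε) :
    Nonempty (BalabanBanachStep G r M) := by
  have hlog : 0 < Real.log M := Real.log_pos (by exact_mod_cast hM)
  have hκ : 0 < B / Real.log M := div_pos hB hlog
  refine nonempty_of_thinChartFunctional r M hM hlog hκ (fun _ => cInd r) (fun _ => cInd_curvature r)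
    (fun p S n σ f => expectC r M (B / Real.log M) hM n σ p S f) ?_ ?_ ?_
  · intro p S n σ f _ _
    exact expectC_step r M _ hM n σ p S f
  · intro g hg L n σ f
    exact expectC_wilson r M _ hM hMo n σ hg L f
  · intro S n σ f hf
    exact (continuous_expectC r M hM hB hUOT n σ S f hf).continuousOn

/-- The thin maps on the chart `ℝ × ℝ` carry the exact smooth half-chart normal form of the line
`perfect-action-regulator-chart` (`C = 1`, `b = 1 · log M`, `δ = 1`, `R = 2`, `θ′ = ½`). [folklore] -/
theorem smoothHalfChart_thin₂ :
    SmoothHalfChart (ℝ × ℝ) (fun g _ => φJ M g) (fun _ y => (1 / 2 : ℝ) • y)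
      ((1 / 2 : ℝ) • ContinuousLinearMap.id ℝ (ℝ × ℝ))
      (fun g _ => 1 + 3 * Real.log M * g ^ 2) (fun _ _ => 0) (fun _ _ => 0)
      (fun _ _ => (1 / 2 : ℝ) • ContinuousLinearMap.id ℝ (ℝ × ℝ))
      (1 * Real.log M) 1 1 2 (1 / 2) where
  δ_pos := one_pos
  δ_le_R := by norm_num
  C_nonneg := zero_le_one
  θ'_nonneg := by norm_num
  φ_zero _ _ := by simp [φJ]
  Ψ_zero_zero := smul_zero _
  hasDeriv_φ g _ _ _ := by
    have h3 : HasDerivAt (fun t : ℝ => t ^ 3) (3 * g ^ 2) g := by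
      simpa using hasDerivAt_pow 3 g
    have h := (hasDerivAt_id g).add (h3.const_mul (Real.log M))
    have e : (1 : ℝ) + Real.log M * (3 * g ^ 2) = 1 + 3 * Real.log M * g ^ 2 := by ring
    rw [e] at h
    exact h.hasDerivWithinAt
  hasFDeriv_φ _ _ _ _ := hasFDerivWithinAt_const _ _ _
  hasDeriv_Ψ _ _ y _ := hasDerivWithinAt_const _ _ _
  hasFDeriv_Ψ _ _ _ _ := ((1 / 2 : ℝ) • ContinuousLinearMap.id ℝ (ℝ × ℝ)).hasFDerivWithinAt
  φg_bound g hg y _ := by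
    have : (1 + 3 * Real.log M * g ^ 2) - (1 + 3 * (1 * Real.log M) * g ^ 2) = 0 := by ring
    rw [this, abs_zero]
    have := hg.1
    positivity
  φy_bound g hg _ _ := by rw [norm_zero]; have := hg.1; positivity
  Ψg_bound g hg y _ := by rw [norm_zero]; have := hg.1; positivity
  Ψy_sub_A g hg y _ := by rw [sub_self, norm_zero]; have := hg.1; positivity
  Ψy_bound _ _ _ _ := norm_half_id_le

/-- **The over-tuned thin inhabitant of the line's object.** Under the same RG-free hypothesis (uniform
over-tuned triviality at some slope `B > 0`), for odd `M ≥ 2` the perfect-action regulator chart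
`RegulatorChart G r M` of line `perfect-action-regulator-chart` — smooth half-chart normal form, Wilson arc,
dictionary, curvature chart functions with inside-chart covariance, arc identification and chart continuity —
is inhabited by the thin polynomial maps on `E = ℝ × ℝ` and the pure-curvature restriction of `expectC`:
no regulator, no polymer norm, no perfect action. So the line's load-bearing stub `stub_regulatorChartOdd`
asks for no more than over-tuned triviality. [folklore] -/
theorem nonempty_regulatorChart_of_uniformOverTuned (hMo : Odd M) (hM : 2 ≤ M) {B : ℝ} (hB : 0 < B)
    (hUOT : ∀ (B' : ℝ) (L m : ℕ) (h : Fin (m + 1) → 𝓢(EuclideanSpace ℝ (Fin 4), ℝ)),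
      IsOffDiagonal (SchwartzMap.tensorFin (m + 1) fun i => ofRealTest (h i)) →
      ∀ ε > 0, ∃ k₀ : ℕ, ∀ k ≥ k₀, ∀ β : ℝ, B * k - B' ≤ β →
        |wilsonCentredSchwinger r.ρ β ((M ^ k * (2 * L + 1) - 1) / 2) (fun _ => 1) (m + 1)
          (fun _ => r.curvature) (fun i => (blockDilate M)^[k] (h i))| ≤ ε) :
    Nonempty (RegulatorChart G r M) := by
  have hlog : 0 < Real.log M := Real.log_pos (by exact_mod_cast hM)
  have hκ : 0 < B / Real.log M := div_pos hB hlog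
  refine ⟨{
    two_le_M := hM
    E := ℝ × ℝ
    φ := fun g _ => φJ M g
    Ψ := fun _ y => (1 / 2 : ℝ) • y
    A := (1 / 2 : ℝ) • ContinuousLinearMap.id ℝ (ℝ × ℝ)
    φg := fun g _ => 1 + 3 * Real.log M * g ^ 2
    φy := fun _ _ => 0
    Ψg := fun _ _ => 0
    Ψy := fun _ _ => (1 / 2 : ℝ) • ContinuousLinearMap.id ℝ (ℝ × ℝ)
    b₀ := 1
    θ := 1 / 2
    C := 1
    δ := 1
    R := 2
    θ' := 1 / 2
    b₀_pos := one_pos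
    θ_nonneg := by norm_num
    θ_lt_one := by norm_num
    norm_A_le := norm_half_id_le
    θ'_lt_one := by norm_num
    smooth := smoothHalfChart_thin₂ M
    yW := fun g => ((1 : ℝ), g)
    g₀ := 1
    betaOf := fun g => B / Real.log M / g ^ 2
    κ := B / Real.log M
    K := 0
    corr := fun p S n f => expectC r M (B / Real.log M) hM n (fun _ => r.curvature) p S f
    realisation := {
      g₀_pos := one_pos
      g₀_le_δ := le_rfl
      continuousOn_yW := by fun_prop
      norm_yW_le := fun g hg => by
        rw [Prod.norm_def, Real.norm_eq_abs, Real.norm_eq_abs, abs_one, abs_of_nonneg hg.1]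
        exact max_le (by norm_num) (hg.2.trans (by norm_num))
      strictAntiOn_betaOf := by
        intro t ht t' ht' hlt
        simp only
        rw [div_lt_div_iff_of_pos_left hκ (by have := ht'.1; positivity) (by have := ht.1; positivity)]
        exact pow_lt_pow_left₀ hlt ht.1.le two_ne_zero
      continuousOn_betaOf := by
        refine continuousOn_of_forall_continuousAt fun t ht => ?_
        have : t ^ 2 ≠ 0 := by have := ht.1; positivity
        fun_prop (disch := assumption)
      κ_pos := hκ
      betaOf_sub_le := fun g _ => by simp
      corr_step := fun g y _ _ _ _ S n f => expectC_step r M _ hM n _ (g, y) S f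
      corr_wilson := fun g hg L n f => by
        change expectC r M (B / Real.log M) hM n (fun _ => r.curvature) (g, ((1 : ℝ), g)) (2 * L + 1) f = _
        rw [expectC_wilson r M _ hM hMo n _ hg L f, wilsonCentredSchwinger_cInd, if_pos fun _ => rfl]
      corr_continuousOn := fun S n f hf =>
        (continuous_expectC r M hM hB hUOT n _ S f hf).continuousOn } }⟩

end Inhabitant



section Equiv

variable {G : Type} [Group G] [TopologicalSpace G] [IsTopologicalGroup G] [CompactSpace G]
  [MeasurableSpace G] [BorelSpace G] (r : LatticeRep G) (M : ℕ)

/-- **Sequential ⇒ uniform.** Every inhabitant at odd `M` forces UNIFORM over-tuned triviality at some slope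
`B > 0` (from `overtuned_trivial_of_nonempty`, slope `B = 2/A`, by contradiction along a violating sequence). [folklore] -/
theorem uniformOverTuned_of_nonempty (hMo : Odd M) (hS : Nonempty (BalabanBanachStep G r M)) :
    ∃ B : ℝ, 0 < B ∧ ∀ (B' : ℝ) (L m : ℕ) (h : Fin (m + 1) → 𝓢(EuclideanSpace ℝ (Fin 4), ℝ)),
      IsOffDiagonal (SchwartzMap.tensorFin (m + 1) fun i => ofRealTest (h i)) →
      ∀ ε > 0, ∃ k₀ : ℕ, ∀ k ≥ k₀, ∀ β : ℝ, B * k - B' ≤ β →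
        |wilsonCentredSchwinger r.ρ β ((M ^ k * (2 * L + 1) - 1) / 2) (fun _ => 1) (m + 1)
          (fun _ => r.curvature) (fun i => (blockDilate M)^[k] (h i))| ≤ ε := by
  obtain ⟨β₀, A, hA, hseq⟩ := overtuned_trivial_of_nonempty (G := G) (r := r) (M := M) hMo hS
  refine ⟨2 / A, by positivity, fun B' L m h hh ε hε => ?_⟩
  by_contra hnot
  push Not at hnot
  -- a violating sequence: k i ≥ i, β i ≥ (2/A) k i − B', |W| > ε
  choose k hk β hβ hW using fun k₀ : ℕ => hnot k₀
  -- shift so that β ≥ β₀ and k ≤ A β hold everywhere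
  obtain ⟨i₀, hi₀⟩ : ∃ i₀ : ℕ, ∀ i ≥ i₀, β₀ ≤ β i ∧ (k i : ℝ) ≤ A * β i := by
    obtain ⟨N, hN⟩ := exists_nat_gt (max (A * (β₀ + B') / 2) (A * B'))
    refine ⟨N, fun i hi => ?_⟩
    have hki : (N : ℝ) ≤ k i := by exact_mod_cast (le_trans hi (hk i))
    have hkiA : (2 / A) * (k i) - B' ≤ β i := hβ i
    have h1 : A * (β₀ + B') / 2 < k i := lt_of_lt_of_le (lt_of_le_of_lt (le_max_left _ _) hN) hki
    have h2 : A * B' < k i := lt_of_lt_of_le (lt_of_le_of_lt (le_max_right _ _) hN) hki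
    constructor
    · -- β i ≥ (2/A) k i − B' > β₀
      have : (2 / A) * (A * (β₀ + B') / 2) = β₀ + B' := by field_simp
      have h3 : (2 / A) * (A * (β₀ + B') / 2) < (2 / A) * (k i) := by
        apply mul_lt_mul_of_pos_left h1 (by positivity)
      linarith
    · -- k i ≤ A β i  ⟸  k i ≤ A((2/A) k i − B') = 2 k i − A B'
      have h3 : A * ((2 / A) * (k i) - B') ≤ A * β i := mul_le_mul_of_nonneg_left hkiA hA.le
      have e : A * ((2 / A) * (k i) - B') = 2 * (k i) - A * B' := by field_simp
      rw [e] at h3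
      linarith
  have hlim := hseq (fun i => β (i + i₀)) (fun i => k (i + i₀)) (fun i => (hi₀ (i + i₀) (by omega)).1)
    (tendsto_add_atTop_nat i₀ |> fun h => ?_) (fun i => (hi₀ (i + i₀) (by omega)).2) L m h hh
  · have hev := (Metric.tendsto_nhds.1 hlim) ε hε
    obtain ⟨i, hi⟩ := hev.exists
    rw [Real.dist_eq, sub_zero] at hi
    exact (not_lt.2 (hW (i + i₀)).le) hi
  · -- Tendsto (fun i => k (i + i₀)) atTop atTop
    exact tendsto_atTop_mono (fun i => hk (i + i₀)) h

/-- **The crux's structure at odd `M` is inhabited iff uniform over-tuned triviality holds at some slope.**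
For odd `M ≥ 2`, every compact `G` and every `r : LatticeRep G`:
`Nonempty (BalabanBanachStep G r M) ↔ ∃ B > 0, UOT(r, M, B)` — the right-hand side mentions Wilson's lattice
gauge theory only. [folklore] -/
theorem nonempty_iff_uniformOverTuned (hMo : Odd M) (hM : 2 ≤ M) :
    Nonempty (BalabanBanachStep G r M) ↔
      ∃ B : ℝ, 0 < B ∧ ∀ (B' : ℝ) (L m : ℕ) (h : Fin (m + 1) → 𝓢(EuclideanSpace ℝ (Fin 4), ℝ)),
        IsOffDiagonal (SchwartzMap.tensorFin (m + 1) fun i => ofRealTest (h i)) →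
        ∀ ε > 0, ∃ k₀ : ℕ, ∀ k ≥ k₀, ∀ β : ℝ, B * k - B' ≤ β →
          |wilsonCentredSchwinger r.ρ β ((M ^ k * (2 * L + 1) - 1) / 2) (fun _ => 1) (m + 1)
            (fun _ => r.curvature) (fun i => (blockDilate M)^[k] (h i))| ≤ ε :=
  ⟨uniformOverTuned_of_nonempty r M hMo, fun ⟨_, hB, h⟩ => nonempty_of_uniformOverTuned r M hMo hM hB h⟩

/-- The line's object realises the crux's structure (composition of the landed stubs `stub_parabolicBlock` and
`stub_realisation` of line `perfect-action-regulator-chart`, per `(G, r, M)`). [folklore] -/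
theorem nonempty_step_of_regulatorChart (h : Nonempty (RegulatorChart G r M)) :
    Nonempty (BalabanBanachStep G r M) := by
  obtain ⟨𝒞⟩ := h
  have hs := 𝒞.smooth
  obtain ⟨φ', Ψ', C', hC', hagree, hPB, hBB⟩ :=
    Summit.QuantumFields.YangMills.Theorems.BalabanStepParabolic.stub_parabolicBlock 𝒞.E 𝒞.φ 𝒞.Ψ 𝒞.A
      𝒞.φg 𝒞.φy 𝒞.Ψg 𝒞.Ψy (𝒞.b₀ * Real.log M) 𝒞.C 𝒞.δ 𝒞.R 𝒞.θ' hs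
  exact Summit.QuantumFields.YangMills.Theorems.BalabanStepParabolic.stub_realisation G r M 𝒞.E φ' Ψ' 𝒞.A
    𝒞.b₀ 𝒞.θ C' 𝒞.δ 𝒞.R 𝒞.θ' 𝒞.two_le_M 𝒞.b₀_pos 𝒞.θ_nonneg 𝒞.θ_lt_one 𝒞.norm_A_le hC' hs.δ_pos
    hs.δ_le_R hs.θ'_nonneg 𝒞.θ'_lt_one hPB hBB 𝒞.yW 𝒞.g₀ 𝒞.betaOf 𝒞.κ 𝒞.K 𝒞.corr
    (𝒞.realisation.congr hagree)

/-- **The line's object at odd `M` is inhabited iff uniform over-tuned triviality holds at some slope**: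
`Nonempty (RegulatorChart G r M) ↔ ∃ B > 0, UOT(r, M, B)` for odd `M ≥ 2` — so the load-bearing stub
`stub_regulatorChartOdd` of line `perfect-action-regulator-chart` is, per `(G, r, M)`, exactly this RG-free
statement about Wilson's theory in the over-tuned weak-coupling regime. [folklore] -/
theorem nonempty_regulatorChart_iff_uniformOverTuned (hMo : Odd M) (hM : 2 ≤ M) :
    Nonempty (RegulatorChart G r M) ↔
      ∃ B : ℝ, 0 < B ∧ ∀ (B' : ℝ) (L m : ℕ) (h : Fin (m + 1) → 𝓢(EuclideanSpace ℝ (Fin 4), ℝ)),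
        IsOffDiagonal (SchwartzMap.tensorFin (m + 1) fun i => ofRealTest (h i)) →
        ∀ ε > 0, ∃ k₀ : ℕ, ∀ k ≥ k₀, ∀ β : ℝ, B * k - B' ≤ β →
          |wilsonCentredSchwinger r.ρ β ((M ^ k * (2 * L + 1) - 1) / 2) (fun _ => 1) (m + 1)
            (fun _ => r.curvature) (fun i => (blockDilate M)^[k] (h i))| ≤ ε :=
  ⟨fun h => uniformOverTuned_of_nonempty r M hMo (nonempty_step_of_regulatorChart r M h),
    fun ⟨_, hB, h⟩ => nonempty_regulatorChart_of_uniformOverTuned r M hMo hM hB h⟩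

end Equiv

end

end Summit.QuantumFields.YangMills.Theorems.BalabanStepParabolic.Negative
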